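/-
Copyright: lit-balaban Phase-2 proof seat p08 (gen 8).  Statement-level skeleton of a published paper; no proof claims beyond what
the kernel checks below.
-/
import Literature.MathematicalPhysics.QuantumFieldTheory.BalabanImbrieJaffe1984to88.BIJ85CurlyDkDecayTorus

/-!
# `BalabanImbrieJaffe1984to88.BIJ85CurlyDkGradTorus` — T. Bałaban, J. Imbrie, A. Jaffe, *Renormalization of the Higgs model: minimizers,
propagators and the stability of mean field theory*, Commun. Math. Phys. **97** (1985) 299–329 [BalabanImbrieJaffe1985]: Sect. 7.2,
p. 326, **the exponential decay of the GRADIENT of the propagator `𝒟_k = Σ_{j<k} H_jC^{(j)}H_j*` (4.4.4) ON THE TORI FOR THE `𝒟_k` OF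
RECORD** (p11's `DkE P η_k^d L^k k`), **GIVEN ONLY [6I] PROPOSITION 1.2** (`B5.Prop12Printed`) — companion of `BIJ85CurlyDkDecayTorus`
(the kernel itself)

statement-level skeleton of published theorems with citation tags; proofs where landed; nothing here is a claim about the Yang–Mills mass gap

PDF held: `paper:balaban1985-cmp97-bij-higgs-minimizers` (journal page = PDF page + 298), p. 312 [PDF 14], pp. 325–326 [PDF 27–28]
(text layer `~/.lit/texts/paper-balaban1985-cmp97-bij-higgs-minimizers/p0014.txt`, `p0027.txt`, `p0028.txt`, re-read this session);
[6I] = [Balaban1984PropagatorsI] Prop. 1.2 (tree name `Balaban1983to89.B5.Prop12Printed`).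

CITATION HEADER (lean-in-tree rule).  Part of the lit-balaban TYPED SKELETON (HOME `run/shared/lean/pub/lit-balaban/`), Phase-2 proof
seat p08 (gen 8), unit `lit-balaban-p08`; WHAT IS REPRODUCED = the located sentence of SKELETON row **C1.Eq7.2.4** (owner r15, referee
ref-5) *"the operators 𝒟_k have the properties of G_k in [6I] Prop 1.2 (exponential decay, singularities on the diagonal) by (4.4.4)"*,
GRADIENT MEMBER ([6I] Proposition 1.2 bounds `G_k` and `∇G_k`), for the `𝒟_k` of record of rows **C1.Eq4.4.4** / **C2.Eq2.12**, kind
«model instance».  TAKING line HOME/STATUS.md 2026-08-21T19:32:24Z.  Decls used BY NAME (nothing restated): p08 g8's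
`BIJ85CurlyDkDecayTorus.dkKernel_eq_sum` (the kernel formula, p300921); p08 g7's `BIJ88Ineq217Ineq722Torus.ofLp_HkE_single`/
`exists_bound_of_ineq722`/`torusKernelData_gradH_nonneg`, `BIJ88Decay216Torus.triple_sum_le`; r18's
`BIJ88Decay216Native.abs_inner_cE_ambient_le`; p09's `ineq723_CE_lt` (via `BIJ88Decay216Prop12.ineq723_CE_torus`),
`ineq722_deltaA_of_prop12Printed`, `torusKernelData_gradH`, `torusRep`/`distEU`/`levStd`; r15's typed `BIJ85Sect7Statements.KernelData.Ineq722`.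

THE PRINTED TEXT (p. 326 [PDF 28], verbatim): *"The operators 𝒟_k have the same properties as the operators G_k in [6I], Proposition 1.2,
with exponential decay but singularities on the diagonal. These properties follow from (4.4.4) and the above estimates on H_k, C^{(k)}."*;
"the above estimates" = (7.2.2) p. 325 *"The kernel H_{k,μν}(x,y) and its gradient decay exponentially. In particular there exists δ > 0 and
for 0 ≦ α < 1 a constant M = M(α) < ∞ such that for |x − x′| ≦ 1, |H_{k,μν}(x,y)| + |∇H_{k,μν}(x,y)| + |x − x′|^{−α}|∇H_{k,μν}(x,y) −
∇H_{k,μν}(x′,y)| ≦ Me^{−δ|x−y|}. (7.2.2)"* and (7.2.3) *"|C^{(k)}_{μν}(x,y)| ≦ Me^{−δ|x−y|}"*; (4.4.4) p. 312 *"𝒟_k = Σ_{j=0}^{k−1}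
H_jC^{(j)}H_j*"*.

THE TORUS DATA (all in the tree; as in the companion file): tori `Balaban1983to89.Setup`/`Params` (`d ≥ 2`, standing range
`k ≤ m + K`, `η_k = L^{−k}`); `η`-bonds `b = ⟨b₋, μ⟩ : PBond P 0`, the shifted bond `⟨b₋ + ηe_λ, μ⟩ = ⟨b.src.shift λ, b.dir⟩`; the
`ℓ^∞` distance `|b₋ − b″₋|_∞/L^k` in the unit of `T₁^{(k)}`; the kernel `𝒟_k(b, b″) := (𝒟_ke_{b″})(b)` of p11's `DkE P η_k^d L^k k`; the
typed gradient member of p09's carrier `torusKernelData`: `gradH = ‖λ ↦ L^j(H_{j,μν}(x+e_λ; y) − H_{j,μν}(x; y))‖` (`torusKernelData_gradH`).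

WHAT IS PROVED (0 `sorry`, standard axioms; theorems only — proof lane; every `d ≥ 2`):
* §1 **`dkKernel_shift_sub_eq_sum`**: `𝒟_k(⟨b₋+e_λ, μ⟩, b″) − 𝒟_k(b, b″) = Σ_{j<k}Σ_{b₁,b₂} (H_j(⟨b₋+e_λ, μ⟩, b₁) − H_j(b, b₁))C^{(j)}(b₁, b₂)
  H_j(b″, b₂)` (any weights).
* §2 **`abs_gradTermDk_le`**: the scale-`j` term of the difference is at most `L^{−j}·M²M_C(L^{k−j})^{d−2}·d²e^{a/2}K(a)²·e^{−a|b₋−b″₋|_∞/L^j}`,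
  `a = min(δ, δ_C)/2`, from the sup and gradient members of (7.2.2) and the unit-lattice (7.2.3).
* §3 **`abs_dkKernel_shift_sub_le`**: for `D = |b₋ − b″₋|_∞/L^k ≥ 2`, `|𝒟_k(⟨b₋+e_λ, μ⟩, b″) − 𝒟_k(b, b″)| ≤ L^{−k}·M²M_C·d²e^{a/2}K(a)²·
  d!/a^d·e^{−(a/2)D}` — the scaling factor is now `L^{−k}(L^{k−j})^{d−1}`, still summable against `e^{−aL^{k−j}D}`; uniform in `k`.
* §4 **`gradDk_torus_of_ineq722_lt`** and **`gradDk_torus_prop12`**: `∃ R₀ c₁ δ′, 0 < δ′ ∧ 0 ≤ c₁ ∧ ∀ k ≤ m + K, ∀ b λ b″,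
  R₀ ≤ |b₋ − b″₋|_∞/L^k → L^k·|𝒟_k(⟨b₋+e_λ, μ⟩, b″) − 𝒟_k(b, b″)| ≤ c₁e^{−δ′|b₋ − b″₋|_∞/L^k}` GIVEN ONLY `B5.Prop12Printed` — the
  `η`-lattice derivative `η⁻¹(𝒟_k(b + ηe_λ, b″) − 𝒟_k(b, b″))` of the kernel decays exponentially with `k`-independent constants.
HONEST SCOPE.  (i) The derivative is taken in the FIRST argument only (the second follows by the symmetry of `𝒟_k`, not proved here);
the HÖLDER member of [6I] Prop. 1.2 / (7.2.2) (`|x − x′|^{−α}|∇· (x) − ∇· (x′)|`) is NOT treated; no short-distance statement.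
(ii) The remaining hypothesis is [6I] Proposition 1.2 BY NAME for the torus settings `settingOf (torusRep P (levStd P i) …) i`; its
constants, hence `(R₀, c₁, δ′)`, are existential PER TORUS `P` (uniform in `k ≤ m + K`).  (iii) `ℓ^∞` distances in the unit `L^kη`,
measured from the UNSHIFTED `b₋`; threshold `2`; constants explicit, not optimal; `U = 1`, real abelian fields, torus, standing range.
(iv) No `def`, no new named fact, nothing restated; NOT summit progress.  Unit `lit-balaban-p08` (literature-prover-lit-balaban-p08-g8-0),
2026-08-21.
-/

open scoped BigOperators RealInnerProductSpace

namespace Literature.MathematicalPhysics.QuantumFieldTheory.BalabanImbrieJaffe1984to88.BIJ85CurlyDkGradTorus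

open Balaban1983to89 hiding Site Plaq
open Balaban1983to89.LatticeFieldCalculus
open BIJ88SigmaKernelDkTorus BIJ88Ineq217Ineq722Torus BIJ88Decay216Torus
open BIJ85AxialPropagator411 BIJ85Prop521Torus BIJ85Prop522Torus BIJ85Sigma422Eta
open BIJ85Sect7Statements BIJ85Ineq722Torus BIJ85Eq721MinimizerKernel
open BIJ85Ineq722DeltaA (deltaAData ineq722_deltaA_of_prop12Printed)
open BIJ85Ineq722ProofPart2 (settingOf)
open BIJ88Decay216Native (abs_inner_cE_ambient_le)
open BIJ88Decay216Prop12 (ineq723_CE_torus)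
open BIJ85CurlyDkDecayTorus (dkKernel_eq_sum)
-- inside this namespace the bare `Site`/`Plaq` are the `ℤ^d` carriers of the QFT root; the torus ones are renamed:
open Balaban1983to89 renaming Site → TSite, Plaq → TPlaq

noncomputable section

variable {P : Params}

/-! ## §1  The first difference of the kernel in its first argument -/

/-- **THE `η`-LATTICE DIFFERENCE OF `𝒟_k(·, b″)`** through the differences of the Landau kernels:
`𝒟_k(⟨b₋+e_λ, μ⟩, b″) − 𝒟_k(b, b″) = Σ_{j<k}Σ_{b₁,b₂} (H_j(⟨b₋+e_λ, μ⟩, b₁) − H_j(b, b₁))·C^{(j)}(b₁, b₂)·H_j(b″, b₂)` ((4.4.4) entrywise,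
`dkKernel_eq_sum`; any weights). [cite: BalabanImbrieJaffe1985, (4.4.4) p.312] -/
theorem dkKernel_shift_sub_eq_sum (w c : ℝ) (k : ℕ) (b b'' : PBond P 0) (lam : Fin P.d) :
    DkE P w c k (toE P (Pi.single b'' 1)) ⟨b.src.shift lam, b.dir⟩ - DkE P w c k (toE P (Pi.single b'' 1)) b =
      ∑ j ∈ Finset.range k, ∑ b₁ : PBond P j, ∑ b₂ : PBond P j,
        (HkE P w c j (toEj P j (Pi.single b₁ 1)) ⟨b.src.shift lam, b.dir⟩ - HkE P w c j (toEj P j (Pi.single b₁ 1)) b) *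
          ⟪toEj P j (Pi.single b₁ 1), CE P w c j (toEj P j (Pi.single b₂ 1))⟫ *
          HkE P w c j (toEj P j (Pi.single b₂ 1)) b'' := by
  rw [dkKernel_eq_sum, dkKernel_eq_sum, ← Finset.sum_sub_distrib]
  refine Finset.sum_congr rfl fun j _ => ?_
  rw [← Finset.sum_sub_distrib]
  refine Finset.sum_congr rfl fun b₁ _ => ?_
  rw [← Finset.sum_sub_distrib]
  refine Finset.sum_congr rfl fun b₂ _ => ?_
  ring

/-! ## §2  The scale-`j` term of the difference: the gradient member of (7.2.2) -/

/-- `Σ_b f(b₋) = d·Σ_y f(y)` on `T^{(j)}`. [folklore] -/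
private theorem sum_bond_src {j : ℕ} (f : TSite P j → ℝ) : ∑ b : PBond P j, f b.src = (P.d : ℝ) * ∑ y : TSite P j, f y := by
  rw [← Fintype.sum_equiv (LatticeFieldCalculus.bondEquiv (P := P) (j := j)) (fun q : TSite P j × Fin P.d => f q.1) _
    (fun q => rfl), Fintype.sum_prod_type]
  simp only [Finset.sum_const, Finset.card_univ, Fintype.card_fin, nsmul_eq_mul]
  rw [Finset.mul_sum]

/-- `0 < L^n`. [folklore] -/
private theorem cast_pow_L_pos' (n : ℕ) : (0 : ℝ) < (P.L : ℝ) ^ n := pow_pos P.cast_L_pos n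

/-- **THE SCALE-`j` TERM OF THE DIFFERENCE** (`j ≤ k`, `j ≤ m + K`, every `d ≥ 2`): given the sup AND the gradient members of (7.2.2)
for the scale-`j` Landau kernel (`|H_{j,μν}(x; y)| ≤ Me^{−δ|x−y|}`, `‖L^j(H_{j,μν}(x+e_λ; y) − H_{j,μν}(x; y))‖ ≤ Me^{−δ|x−y|}`) and
(7.2.3) for the unit-lattice matrix of `C^{(j)}`, the term is at most `L^{−j}·M²·M_C(L^{k−j})^{d−2}·d²e^{a/2}K(a)²·e^{−a|b₋−b″₋|_∞/L^j}`,
`a = min(δ, δ_C)/2` — one factor `L^{−j}` better than the kernel's term (the η-difference of `H_j` costs `(L^jη)·η⁻¹… = L^{−j}`).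
[cite: BalabanImbrieJaffe1985, (4.4.4) p.312] -/
theorem abs_gradTermDk_le (hd : 2 ≤ P.d) {k j : ℕ} (hj : j ≤ P.m + P.K) (hjk : j ≤ k) {a : ℝ} (ha : 0 < a)
    {δ M δC MC : ℝ} (hδ : 0 < δ) (hδC : 0 < δC)
    (hH : ∀ (μ ν : Fin P.d) (x : TSite P 0) (y : TSite P j),
      |(torusRep P j (deltaAData hj a)).H (x, μ) (y, ν)| ≤ M * Real.exp (-(δ * distEU P j x y)))
    (hB : ∀ (μ ν : Fin P.d) (x : TSite P 0) (y : TSite P j),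
      ‖fun lam : Fin P.d => (P.L : ℝ) ^ j *
          ((torusRep P j (deltaAData hj a)).H (x.shift lam, μ) (y, ν) - (torusRep P j (deltaAData hj a)).H (x, μ) (y, ν))‖ ≤
        M * Real.exp (-(δ * distEU P j x y)))
    (hC : ∀ b₁ b₂ : PBond P j, |⟪toEj P j (Pi.single b₁ 1),
      CE P ((P.eta j) ^ P.d) ((P.L : ℝ) ^ j) j (toEj P j (Pi.single b₂ 1))⟫| ≤ MC * Real.exp (-(δC * (supDist b₁.src b₂.src : ℝ))))
    (b b'' : PBond P 0) (lam : Fin P.d) :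
    |∑ b₁ : PBond P j, ∑ b₂ : PBond P j,
        (HkE P ((P.eta k) ^ P.d) ((P.L : ℝ) ^ k) j (toEj P j (Pi.single b₁ 1)) ⟨b.src.shift lam, b.dir⟩ -
            HkE P ((P.eta k) ^ P.d) ((P.L : ℝ) ^ k) j (toEj P j (Pi.single b₁ 1)) b) *
          ⟪toEj P j (Pi.single b₁ 1), CE P ((P.eta k) ^ P.d) ((P.L : ℝ) ^ k) j (toEj P j (Pi.single b₂ 1))⟫ *
          HkE P ((P.eta k) ^ P.d) ((P.L : ℝ) ^ k) j (toEj P j (Pi.single b₂ 1)) b''| ≤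
      ((P.L : ℝ) ^ j)⁻¹ * (M ^ 2 * (MC * ((P.L : ℝ) ^ (k - j)) ^ (P.d - 2)) * (P.d : ℝ) ^ 2 *
        (Real.exp (min δ δC / 2 / 2) * ((2 * (1 + P.d / (min δ δC / 2))) ^ P.d) ^ 2) *
        Real.exp (-(min δ δC / 2 * ((supDist b.src b''.src : ℝ) / (P.L : ℝ) ^ j)))) := by
  have hw : 0 < (P.eta k) ^ P.d := pow_pos (eta_pos P k) _
  have hc : (P.L : ℝ) ^ k ≠ 0 := (cast_pow_L_pos' k).ne'
  have hLj : 0 < (P.L : ℝ) ^ j := cast_pow_L_pos' j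
  have hM : 0 ≤ M := by
    have h := hH ⟨0, P.hd⟩ ⟨0, P.hd⟩ default default
    exact (mul_nonneg_iff_of_pos_right (Real.exp_pos _)).1 ((abs_nonneg _).trans h)
  have hMC : 0 ≤ MC := by
    have h := hC ⟨default, ⟨0, P.hd⟩⟩ ⟨default, ⟨0, P.hd⟩⟩
    exact (mul_nonneg_iff_of_pos_right (Real.exp_pos _)).1 ((abs_nonneg _).trans h)
  -- the entries of `H_j` and of its `η`-difference
  have hent : ∀ (x : TSite P 0) (μ : Fin P.d) (b₁ : PBond P j),
      HkE P ((P.eta k) ^ P.d) ((P.L : ℝ) ^ k) j (toEj P j (Pi.single b₁ 1)) ⟨x, μ⟩ =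
        (torusRep P j (deltaAData hj a)).H (x, μ) (b₁.src, b₁.dir) := fun x μ b₁ => ofLp_HkE_single hj hc hw ha b₁ x μ
  have hH' : ∀ (b₀ : PBond P 0) (b₁ : PBond P j),
      |HkE P ((P.eta k) ^ P.d) ((P.L : ℝ) ^ k) j (toEj P j (Pi.single b₁ 1)) b₀| ≤ M * Real.exp (-(δ * distEU P j b₀.src b₁.src)) := by
    intro b₀ b₁
    rw [show b₀ = ⟨b₀.src, b₀.dir⟩ from rfl, hent]
    exact hH _ _ _ _
  have hD' : ∀ b₁ : PBond P j,
      |HkE P ((P.eta k) ^ P.d) ((P.L : ℝ) ^ k) j (toEj P j (Pi.single b₁ 1)) ⟨b.src.shift lam, b.dir⟩ -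
          HkE P ((P.eta k) ^ P.d) ((P.L : ℝ) ^ k) j (toEj P j (Pi.single b₁ 1)) b| ≤
        ((P.L : ℝ) ^ j)⁻¹ * M * Real.exp (-(δ * distEU P j b.src b₁.src)) := by
    intro b₁
    rw [show b = ⟨b.src, b.dir⟩ from rfl, hent, hent]
    have h1 := (norm_le_pi_norm (fun lam' : Fin P.d => (P.L : ℝ) ^ j *
      ((torusRep P j (deltaAData hj a)).H (b.src.shift lam', b.dir) (b₁.src, b₁.dir) -
        (torusRep P j (deltaAData hj a)).H (b.src, b.dir) (b₁.src, b₁.dir))) lam).trans (hB b.dir b₁.dir b.src b₁.src)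
    rw [Real.norm_eq_abs, abs_mul, abs_of_pos hLj] at h1
    rw [mul_assoc, le_inv_mul_iff₀ hLj]
    exact h1
  have hC' := abs_inner_cE_ambient_le hd hjk hC
  -- termwise bound
  have hpt : ∀ b₁ b₂ : PBond P j,
      |(HkE P ((P.eta k) ^ P.d) ((P.L : ℝ) ^ k) j (toEj P j (Pi.single b₁ 1)) ⟨b.src.shift lam, b.dir⟩ -
            HkE P ((P.eta k) ^ P.d) ((P.L : ℝ) ^ k) j (toEj P j (Pi.single b₁ 1)) b) *
          ⟪toEj P j (Pi.single b₁ 1), CE P ((P.eta k) ^ P.d) ((P.L : ℝ) ^ k) j (toEj P j (Pi.single b₂ 1))⟫ *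
          HkE P ((P.eta k) ^ P.d) ((P.L : ℝ) ^ k) j (toEj P j (Pi.single b₂ 1)) b''| ≤
        ((P.L : ℝ) ^ j)⁻¹ * (M ^ 2 * (MC * ((P.L : ℝ) ^ (k - j)) ^ (P.d - 2))) *
          (Real.exp (-(δ * distEU P j b.src b₁.src)) * Real.exp (-(δC * (supDist b₁.src b₂.src : ℝ))) *
          Real.exp (-(δ * distEU P j b''.src b₂.src))) := by
    intro b₁ b₂
    rw [abs_mul, abs_mul]
    have h1 := hD' b₁
    have h2 := hH' b'' b₂
    have h3 := hC' b₁ b₂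
    calc _ ≤ (((P.L : ℝ) ^ j)⁻¹ * M * Real.exp (-(δ * distEU P j b.src b₁.src))) *
          (MC * ((P.L : ℝ) ^ (k - j)) ^ (P.d - 2) * Real.exp (-(δC * (supDist b₁.src b₂.src : ℝ)))) *
          (M * Real.exp (-(δ * distEU P j b''.src b₂.src))) :=
          mul_le_mul (mul_le_mul h1 h3 (abs_nonneg _) (by positivity)) h2 (abs_nonneg _) (by positivity)
      _ = _ := by ring
  calc _ ≤ ∑ b₁ : PBond P j, ∑ b₂ : PBond P j, ((P.L : ℝ) ^ j)⁻¹ * (M ^ 2 * (MC * ((P.L : ℝ) ^ (k - j)) ^ (P.d - 2))) *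
          (Real.exp (-(δ * distEU P j b.src b₁.src)) * Real.exp (-(δC * (supDist b₁.src b₂.src : ℝ))) *
          Real.exp (-(δ * distEU P j b''.src b₂.src))) :=
        (Finset.abs_sum_le_sum_abs _ _).trans (Finset.sum_le_sum fun b₁ _ =>
          (Finset.abs_sum_le_sum_abs _ _).trans (Finset.sum_le_sum fun b₂ _ => hpt b₁ b₂))
    _ = ((P.L : ℝ) ^ j)⁻¹ * (M ^ 2 * (MC * ((P.L : ℝ) ^ (k - j)) ^ (P.d - 2))) *
          ((P.d : ℝ) * ∑ y : TSite P j, (P.d : ℝ) * ∑ y' : TSite P j, Real.exp (-(δ * distEU P j b.src y)) *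
          Real.exp (-(δC * (supDist y y' : ℝ))) * Real.exp (-(δ * distEU P j b''.src y'))) := by
        rw [← sum_bond_src (fun y => (P.d : ℝ) * ∑ y' : TSite P j, Real.exp (-(δ * distEU P j b.src y)) *
          Real.exp (-(δC * (supDist y y' : ℝ))) * Real.exp (-(δ * distEU P j b''.src y'))), Finset.mul_sum]
        refine Finset.sum_congr rfl fun b₁ _ => ?_
        rw [← sum_bond_src (fun y' => Real.exp (-(δ * distEU P j b.src b₁.src)) * Real.exp (-(δC * (supDist b₁.src y' : ℝ))) *
          Real.exp (-(δ * distEU P j b''.src y'))), Finset.mul_sum]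
    _ = ((P.L : ℝ) ^ j)⁻¹ * (M ^ 2 * (MC * ((P.L : ℝ) ^ (k - j)) ^ (P.d - 2))) * (P.d : ℝ) ^ 2 *
          ∑ y : TSite P j, ∑ y' : TSite P j, Real.exp (-(δ * distEU P j b.src y)) *
          Real.exp (-(δC * (supDist y y' : ℝ))) * Real.exp (-(δ * distEU P j b''.src y')) := by
        rw [← Finset.mul_sum]; ring
    _ ≤ ((P.L : ℝ) ^ j)⁻¹ * (M ^ 2 * (MC * ((P.L : ℝ) ^ (k - j)) ^ (P.d - 2))) * (P.d : ℝ) ^ 2 *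
          (Real.exp (min δ δC / 2 / 2) * ((2 * (1 + P.d / (min δ δC / 2))) ^ P.d) ^ 2 *
          Real.exp (-(min δ δC / 2 * ((supDist b.src b''.src : ℝ) / (P.L : ℝ) ^ j)))) :=
        mul_le_mul_of_nonneg_left (triple_sum_le hj hδ hδC b.src b''.src) (by positivity)
    _ = _ := by ring

/-! ## §3  The multiscale sum: «the rapid decay of the terms with small j» once more, one power of `L^{k−j}` higher -/

/-- `x^q·e^{−ax} ≤ (q+1)!/(a^{q+1}x)` (`a, x > 0`; r18 g8 / p08 g8 private lemma, re-proved). [folklore] -/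
private theorem pow_mul_exp_neg_le {a x : ℝ} (ha : 0 < a) (hx : 0 < x) (q : ℕ) :
    x ^ q * Real.exp (-(a * x)) ≤ ((q + 1).factorial : ℝ) / (a ^ (q + 1) * x) := by
  have h := Real.pow_div_factorial_le_exp (a * x) (by positivity) (q + 1)
  rw [div_le_iff₀ (by positivity)] at h
  rw [le_div_iff₀ (by positivity)]
  calc x ^ q * Real.exp (-(a * x)) * (a ^ (q + 1) * x) = (a * x) ^ (q + 1) * Real.exp (-(a * x)) := by ring
    _ ≤ Real.exp (a * x) * ((q + 1).factorial : ℝ) * Real.exp (-(a * x)) := mul_le_mul_of_nonneg_right h (Real.exp_pos _).le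
    _ = ((q + 1).factorial : ℝ) := by
        rw [mul_comm (Real.exp _), mul_assoc, ← Real.exp_add, add_neg_cancel, Real.exp_zero, mul_one]

/-- `Σ_{j<k} L^{−(k−j)} ≤ 1` (`L ≥ 2`; induction: `S_{k+1} = L⁻¹(S_k + 1)`). [folklore] -/
private theorem sum_inv_pow_le_one (k : ℕ) : ∑ j ∈ Finset.range k, ((P.L : ℝ) ^ (k - j))⁻¹ ≤ 1 := by
  have hL : (2 : ℝ) ≤ P.L := by exact_mod_cast P.hL.2
  induction k with
  | zero => simp
  | succ k ih =>
    have e : ∑ j ∈ Finset.range (k + 1), ((P.L : ℝ) ^ (k + 1 - j))⁻¹ =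
        (P.L : ℝ)⁻¹ * (∑ j ∈ Finset.range k, ((P.L : ℝ) ^ (k - j))⁻¹ + 1) := by
      rw [Finset.sum_range_succ, show k + 1 - k = 1 by omega, pow_one, mul_add, mul_one, Finset.mul_sum]
      refine congrArg (· + _) (Finset.sum_congr rfl fun j hj => ?_)
      rw [show k + 1 - j = (k - j) + 1 by have := Finset.mem_range.1 hj; omega, pow_succ, mul_inv, mul_comm]
    rw [e]
    calc (P.L : ℝ)⁻¹ * (∑ j ∈ Finset.range k, ((P.L : ℝ) ^ (k - j))⁻¹ + 1) ≤ 2⁻¹ * (1 + 1) :=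
          mul_le_mul ((inv_le_inv₀ (by linarith) two_pos).2 hL) (by linarith) (by positivity) (by norm_num)
      _ = 1 := by norm_num

/-- `L^k = L^j·L^{k−j}` for `j ≤ k`. [folklore] -/
private theorem pow_eq_pow_mul_pow' {j k : ℕ} (hjk : j ≤ k) : (P.L : ℝ) ^ k = (P.L : ℝ) ^ j * (P.L : ℝ) ^ (k - j) := by
  rw [← pow_add, Nat.add_sub_cancel' hjk]

/-- **EXPONENTIAL DECAY OF THE GRADIENT OF `𝒟_k(·, b″)` ON THE TORI, explicit constants, every `d ≥ 2`**: for
`D := |b₋ − b″₋|_∞/L^k ≥ 2` and `a = min(δ, δ_C)/2`, the `η`-difference satisfies `|𝒟_k(⟨b₋+e_λ, μ⟩, b″) − 𝒟_k(b, b″)| ≤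
L^{−k}·M²M_C·d²e^{a/2}K(a)²·d!/a^d·e^{−(a/2)D}` — i.e. the `η`-LATTICE DERIVATIVE `η⁻¹(𝒟_k(b+ηe_λ, b″) − 𝒟_k(b, b″))` (`η⁻¹ = L^k`) is
bounded by `c₁e^{−(a/2)D}` UNIFORMLY IN `k` — GIVEN the sup and gradient members of (7.2.2) for every `H_j`, `j < k`, and (7.2.3) for the
unit-lattice `C^{(j)}`: the scale-`j` term of §2 is `≲ L^{−k}ℓ^{d−1}e^{−aℓD}` (`ℓ = L^{k−j}`), `ℓ^{d−1}e^{−aℓ} ≤ d!/(a^dℓ)`, `Σ_{j<k}ℓ⁻¹ ≤ 1`.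
[cite: BalabanImbrieJaffe1985, (4.4.4) p.312] -/
theorem abs_dkKernel_shift_sub_le (hd : 2 ≤ P.d) {k : ℕ} (hk : k ≤ P.m + P.K) {a : ℝ} (ha : 0 < a) {δ M δC MC : ℝ} (hδ : 0 < δ)
    (hδC : 0 < δC) (hMC : 0 ≤ MC)
    (hH : ∀ (j : ℕ) (hj : j ≤ P.m + P.K), j < k → ∀ (μ ν : Fin P.d) (x : TSite P 0) (y : TSite P j),
      |(torusRep P j (deltaAData hj a)).H (x, μ) (y, ν)| ≤ M * Real.exp (-(δ * distEU P j x y)))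
    (hB : ∀ (j : ℕ) (hj : j ≤ P.m + P.K), j < k → ∀ (μ ν : Fin P.d) (x : TSite P 0) (y : TSite P j),
      ‖fun lam : Fin P.d => (P.L : ℝ) ^ j *
          ((torusRep P j (deltaAData hj a)).H (x.shift lam, μ) (y, ν) - (torusRep P j (deltaAData hj a)).H (x, μ) (y, ν))‖ ≤
        M * Real.exp (-(δ * distEU P j x y)))
    (hC : ∀ j < k, ∀ b₁ b₂ : PBond P j, |⟪toEj P j (Pi.single b₁ 1),
      CE P ((P.eta j) ^ P.d) ((P.L : ℝ) ^ j) j (toEj P j (Pi.single b₂ 1))⟫| ≤ MC * Real.exp (-(δC * (supDist b₁.src b₂.src : ℝ))))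
    {b b'' : PBond P 0} (lam : Fin P.d) (hD : 2 ≤ (supDist b.src b''.src : ℝ) / (P.L : ℝ) ^ k) :
    |DkE P ((P.eta k) ^ P.d) ((P.L : ℝ) ^ k) k (toE P (Pi.single b'' 1)) ⟨b.src.shift lam, b.dir⟩ -
        DkE P ((P.eta k) ^ P.d) ((P.L : ℝ) ^ k) k (toE P (Pi.single b'' 1)) b| ≤
      ((P.L : ℝ) ^ k)⁻¹ * (M ^ 2 * MC * ((P.d : ℝ) ^ 2 * (Real.exp (min δ δC / 2 / 2) * ((2 * (1 + P.d / (min δ δC / 2))) ^ P.d) ^ 2)) *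
          (((P.d - 1 + 1).factorial : ℝ) / (min δ δC / 2) ^ (P.d - 1 + 1))) *
        Real.exp (-(min δ δC / 2 / 2 * ((supDist b.src b''.src : ℝ) / (P.L : ℝ) ^ k))) := by
  set a₀ : ℝ := min δ δC / 2 with ha₀
  have ha₀p : 0 < a₀ := by rw [ha₀]; exact half_pos (lt_min hδ hδC)
  set D : ℝ := (supDist b.src b''.src : ℝ) / (P.L : ℝ) ^ k with hDdef
  set K : ℝ := (P.d : ℝ) ^ 2 * (Real.exp (a₀ / 2) * ((2 * (1 + P.d / a₀)) ^ P.d) ^ 2) with hK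
  have hD1 : 1 ≤ D := by linarith
  have hLk : 0 < (P.L : ℝ) ^ k := cast_pow_L_pos' k
  rw [dkKernel_shift_sub_eq_sum]
  -- the scale-`j` term against the scaling factor `L^{−j}(L^{k−j})^{d−2} = L^{−k}(L^{k−j})^{d−1}`
  have hterm : ∀ j ∈ Finset.range k,
      |∑ b₁ : PBond P j, ∑ b₂ : PBond P j,
        (HkE P ((P.eta k) ^ P.d) ((P.L : ℝ) ^ k) j (toEj P j (Pi.single b₁ 1)) ⟨b.src.shift lam, b.dir⟩ -
            HkE P ((P.eta k) ^ P.d) ((P.L : ℝ) ^ k) j (toEj P j (Pi.single b₁ 1)) b) *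
          ⟪toEj P j (Pi.single b₁ 1), CE P ((P.eta k) ^ P.d) ((P.L : ℝ) ^ k) j (toEj P j (Pi.single b₂ 1))⟫ *
          HkE P ((P.eta k) ^ P.d) ((P.L : ℝ) ^ k) j (toEj P j (Pi.single b₂ 1)) b''| ≤
        ((P.L : ℝ) ^ k)⁻¹ * (M ^ 2 * MC * K) * ((((P.d - 1 + 1).factorial : ℝ) / (a₀ ^ (P.d - 1 + 1) * (P.L : ℝ) ^ (k - j))) *
          Real.exp (-(a₀ / 2 * D))) := by
    intro j hjm
    have hjk : j < k := Finset.mem_range.1 hjm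
    have hj : j ≤ P.m + P.K := by omega
    refine (abs_gradTermDk_le hd hj hjk.le ha hδ hδC (hH j hj hjk) (hB j hj hjk) (hC j hjk) b b'' lam).trans ?_
    set ℓ : ℝ := (P.L : ℝ) ^ (k - j) with hℓ
    have hℓ1 : 1 ≤ ℓ := one_le_pow₀ (by exact_mod_cast P.L_pos)
    have hℓ0 : 0 < ℓ := by linarith
    have e1 : (supDist b.src b''.src : ℝ) / (P.L : ℝ) ^ j = ℓ * D := by
      rw [hDdef, pow_eq_pow_mul_pow' hjk.le, ← hℓ]
      field_simp
    have hinv : ((P.L : ℝ) ^ j)⁻¹ = ((P.L : ℝ) ^ k)⁻¹ * ℓ := by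
      rw [pow_eq_pow_mul_pow' hjk.le, ← hℓ, mul_inv, mul_assoc, inv_mul_cancel₀ hℓ0.ne', mul_one]
    have hp : ℓ ^ (P.d - 2) * ℓ = ℓ ^ (P.d - 1) := by
      rw [← pow_succ]; congr 1; omega
    have h1 : ((P.L : ℝ) ^ j)⁻¹ * (M ^ 2 * (MC * ℓ ^ (P.d - 2)) * (P.d : ℝ) ^ 2 *
          (Real.exp (a₀ / 2) * ((2 * (1 + P.d / a₀)) ^ P.d) ^ 2) * Real.exp (-(a₀ * (ℓ * D)))) =
        ((P.L : ℝ) ^ k)⁻¹ * (M ^ 2 * MC * K) * (ℓ ^ (P.d - 1) * Real.exp (-(a₀ * (ℓ * D)))) := by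
      rw [hinv, hK, ← hp]; ring
    have h2 : Real.exp (-(a₀ * (ℓ * D))) ≤ Real.exp (-(a₀ * ℓ)) * Real.exp (-(a₀ / 2 * D)) := by
      rw [← Real.exp_add]
      refine Real.exp_le_exp.2 ?_
      nlinarith [mul_nonneg (sub_nonneg.2 hℓ1) (sub_nonneg.2 hD1), ha₀p.le, mul_nonneg ha₀p.le (sub_nonneg.2 hD1),
        mul_nonneg ha₀p.le (mul_nonneg (sub_nonneg.2 hℓ1) (sub_nonneg.2 hD1))]
    have h4 : ℓ ^ (P.d - 1) * Real.exp (-(a₀ * ℓ)) ≤ ((P.d - 1 + 1).factorial : ℝ) / (a₀ ^ (P.d - 1 + 1) * ℓ) :=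
      pow_mul_exp_neg_le ha₀p hℓ0 (P.d - 1)
    rw [e1, h1]
    refine mul_le_mul_of_nonneg_left ?_ (by positivity)
    calc ℓ ^ (P.d - 1) * Real.exp (-(a₀ * (ℓ * D)))
        ≤ ℓ ^ (P.d - 1) * (Real.exp (-(a₀ * ℓ)) * Real.exp (-(a₀ / 2 * D))) := mul_le_mul_of_nonneg_left h2 (by positivity)
      _ = ℓ ^ (P.d - 1) * Real.exp (-(a₀ * ℓ)) * Real.exp (-(a₀ / 2 * D)) := by ring
      _ ≤ ((P.d - 1 + 1).factorial : ℝ) / (a₀ ^ (P.d - 1 + 1) * ℓ) * Real.exp (-(a₀ / 2 * D)) :=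
          mul_le_mul_of_nonneg_right h4 (Real.exp_pos _).le
  calc _ ≤ ∑ j ∈ Finset.range k, ((P.L : ℝ) ^ k)⁻¹ * (M ^ 2 * MC * K) *
          ((((P.d - 1 + 1).factorial : ℝ) / (a₀ ^ (P.d - 1 + 1) * (P.L : ℝ) ^ (k - j))) * Real.exp (-(a₀ / 2 * D))) :=
        (Finset.abs_sum_le_sum_abs _ _).trans (Finset.sum_le_sum hterm)
    _ = ((P.L : ℝ) ^ k)⁻¹ * (M ^ 2 * MC * K) * (((P.d - 1 + 1).factorial : ℝ) / a₀ ^ (P.d - 1 + 1)) *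
          Real.exp (-(a₀ / 2 * D)) * ∑ j ∈ Finset.range k, ((P.L : ℝ) ^ (k - j))⁻¹ := by
        rw [Finset.mul_sum]
        refine Finset.sum_congr rfl fun j _ => ?_
        field_simp
    _ ≤ ((P.L : ℝ) ^ k)⁻¹ * (M ^ 2 * MC * K) * (((P.d - 1 + 1).factorial : ℝ) / a₀ ^ (P.d - 1 + 1)) *
          Real.exp (-(a₀ / 2 * D)) * 1 :=
        mul_le_mul_of_nonneg_left (sum_inv_pow_le_one k) (by positivity)
    _ = _ := by rw [mul_one]; ring

/-! ## §4  Assembly: the gradient member of the p. 326 sentence on the tori given only [6I] Proposition 1.2 -/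

/-- **`∇𝒟_k` DECAYS EXPONENTIALLY ON THE TORI, FROM THE TYPED (7.2.2) AND THE NATIVE (7.2.3)**, constants UNIFORM IN `k`: given r15's
`KernelData.Ineq722` for p09's kernel family (scales covering the standing range; its `α = 0` instance carries the sup AND the gradient
member) and (7.2.3) for the unit-lattice matrices in the binder shape `∀ k ≤ m + K, ∀ j < k`: `∃ R₀ c₁ δ′, 0 < δ′ ∧ 0 ≤ c₁ ∧ ∀ k ≤ m + K,
∀ b λ b″, R₀ ≤ |b₋ − b″₋|_∞/L^k → L^k·|𝒟_k(⟨b₋+e_λ, μ⟩, b″) − 𝒟_k(b, b″)| ≤ c₁e^{−δ′|b₋ − b″₋|_∞/L^k}` for p11's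
`𝒟_k = DkE P η_k^d L^k k`. [cite: BalabanImbrieJaffe1985, (4.4.4) p.312] -/
theorem gradDk_torus_of_ineq722_lt (hd : 2 ≤ P.d) {lev : ℕ → ℕ} (hlev : ∀ i, lev i ≤ P.m + P.K)
    (hcov : ∀ j ≤ P.m + P.K, ∃ i, lev i = j) {a : ℝ} (ha : 0 < a) {BondU : ℕ → Type}
    {distEB : (i : ℕ) → TSite P 0 → BondU i → ℝ} {Cker : (i : ℕ) → Fin P.d → Fin P.d → TSite P (lev i) → TSite P (lev i) → ℝ}
    {Dker : (i : ℕ) → TSite P 0 → BondU i → ℝ}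
    (h722 : KernelData.Ineq722
      (fun i => torusKernelData P (lev i) (deltaAData (hlev i) a) (BondU i) (distEB i) (Cker i) (Dker i)))
    {δC MC : ℝ} (hδC : 0 < δC) (hMC : 0 ≤ MC)
    (hC : ∀ k ≤ P.m + P.K, ∀ j < k, ∀ b₁ b₂ : PBond P j, |⟪toEj P j (Pi.single b₁ 1),
      CE P ((P.eta j) ^ P.d) ((P.L : ℝ) ^ j) j (toEj P j (Pi.single b₂ 1))⟫| ≤ MC * Real.exp (-(δC * (supDist b₁.src b₂.src : ℝ)))) :
    ∃ R₀ c₁ δ' : ℝ, 0 < δ' ∧ 0 ≤ c₁ ∧ ∀ (k : ℕ) (hk : k ≤ P.m + P.K) (b b'' : PBond P 0) (lam : Fin P.d),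
        R₀ ≤ (supDist b.src b''.src : ℝ) / (P.L : ℝ) ^ k →
        (P.L : ℝ) ^ k * |DkE P ((P.eta k) ^ P.d) ((P.L : ℝ) ^ k) k (toE P (Pi.single b'' 1)) ⟨b.src.shift lam, b.dir⟩ -
            DkE P ((P.eta k) ^ P.d) ((P.L : ℝ) ^ k) k (toE P (Pi.single b'' 1)) b| ≤
          c₁ * Real.exp (-δ' * ((supDist b.src b''.src : ℝ) / (P.L : ℝ) ^ k)) := by
  obtain ⟨δ, M, hδ, -, hBall⟩ := exists_bound_of_ineq722 hlev h722
  refine ⟨2, M ^ 2 * MC * ((P.d : ℝ) ^ 2 * (Real.exp (min δ δC / 2 / 2) * ((2 * (1 + P.d / (min δ δC / 2))) ^ P.d) ^ 2)) *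
      (((P.d - 1 + 1).factorial : ℝ) / (min δ δC / 2) ^ (P.d - 1 + 1)),
    min δ δC / 2 / 2, by positivity, by positivity, fun k hk b b'' lam hfar => ?_⟩
  have hH : ∀ (j : ℕ) (hj : j ≤ P.m + P.K), j < k → ∀ (μ ν : Fin P.d) (x : TSite P 0) (y : TSite P j),
      |(torusRep P j (deltaAData hj a)).H (x, μ) (y, ν)| ≤ M * Real.exp (-(δ * distEU P j x y)) := by
    intro j hj _ μ ν x y
    obtain ⟨i, hi⟩ := hcov j hj
    subst hi
    exact (le_add_of_nonneg_right torusKernelData_gradH_nonneg).trans (hBall i μ ν x y)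
  have hB : ∀ (j : ℕ) (hj : j ≤ P.m + P.K), j < k → ∀ (μ ν : Fin P.d) (x : TSite P 0) (y : TSite P j),
      ‖fun lam : Fin P.d => (P.L : ℝ) ^ j *
          ((torusRep P j (deltaAData hj a)).H (x.shift lam, μ) (y, ν) - (torusRep P j (deltaAData hj a)).H (x, μ) (y, ν))‖ ≤
        M * Real.exp (-(δ * distEU P j x y)) := by
    intro j hj _ μ ν x y
    obtain ⟨i, hi⟩ := hcov j hj
    subst hi
    have h := hBall i μ ν x y
    rw [torusKernelData_gradH] at h
    exact (le_add_of_nonneg_left (abs_nonneg _)).trans h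
  have hLk : 0 < (P.L : ℝ) ^ k := cast_pow_L_pos' k
  have h := abs_dkKernel_shift_sub_le hd hk ha hδ hδC hMC hH hB (fun j hjk => hC k hk j hjk) lam hfar
  rw [neg_mul]
  calc _ ≤ (P.L : ℝ) ^ k * (((P.L : ℝ) ^ k)⁻¹ * (M ^ 2 * MC * ((P.d : ℝ) ^ 2 * (Real.exp (min δ δC / 2 / 2) *
          ((2 * (1 + P.d / (min δ δC / 2))) ^ P.d) ^ 2)) * (((P.d - 1 + 1).factorial : ℝ) / (min δ δC / 2) ^ (P.d - 1 + 1))) *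
          Real.exp (-(min δ δC / 2 / 2 * ((supDist b.src b''.src : ℝ) / (P.L : ℝ) ^ k)))) :=
        mul_le_mul_of_nonneg_left h hLk.le
    _ = _ := by rw [mul_assoc, mul_inv_cancel_left₀ hLk.ne']

/-- **THE GRADIENT MEMBER OF THE p. 326 SENTENCE ON THE TORI GIVEN ONLY [6I] PROPOSITION 1.2 BY ITS TREE NAME** (`B5.Prop12Printed` for
p09's family of scales `levStd`): *"The operators 𝒟_k have the same properties as the operators G_k in [6I], Proposition 1.2, with
exponential decay …"* — Proposition 1.2 bounds `G_k` AND `∇G_k`; here: `∃ R₀ c₁ δ′, 0 < δ′ ∧ 0 ≤ c₁ ∧ ∀ k ≤ m + K, ∀ b λ b″,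
R₀ ≤ |b₋ − b″₋|_∞/L^k → L^k·|𝒟_k(⟨b₋+e_λ, μ⟩, b″) − 𝒟_k(b, b″)| ≤ c₁e^{−δ′|b₋ − b″₋|_∞/L^k}` for the `𝒟_k` OF RECORD
(`L^k = η⁻¹`: the `η`-lattice derivative of the kernel in its first argument); (7.2.2) via p09's `ineq722_deltaA_of_prop12Printed`, (7.2.3) HYPOTHESIS-FREE
by p09's `ineq723_CE_lt`. [cite: BalabanImbrieJaffe1985, (4.4.4) p.312] -/
theorem gradDk_torus_prop12 (hd : 2 ≤ P.d) {a : ℝ} (ha : 0 < a)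
    (h12 : B5.Prop12Printed (fun i => settingOf (torusRep P (levStd P i) (deltaAData (levStd_le i) a)) i)) :
    ∃ R₀ c₁ δ' : ℝ, 0 < δ' ∧ 0 ≤ c₁ ∧ ∀ (k : ℕ) (hk : k ≤ P.m + P.K) (b b'' : PBond P 0) (lam : Fin P.d),
        R₀ ≤ (supDist b.src b''.src : ℝ) / (P.L : ℝ) ^ k →
        (P.L : ℝ) ^ k * |DkE P ((P.eta k) ^ P.d) ((P.L : ℝ) ^ k) k (toE P (Pi.single b'' 1)) ⟨b.src.shift lam, b.dir⟩ -
            DkE P ((P.eta k) ^ P.d) ((P.L : ℝ) ^ k) k (toE P (Pi.single b'' 1)) b| ≤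
          c₁ * Real.exp (-δ' * ((supDist b.src b''.src : ℝ) / (P.L : ℝ) ^ k)) := by
  obtain ⟨MC, δC, hMC, hδC, hC⟩ := ineq723_CE_torus (P := P) hd
  exact gradDk_torus_of_ineq722_lt hd levStd_le (fun j hj => ⟨j, min_eq_left hj⟩) ha
    (ineq722_deltaA_of_prop12Printed (levStd P) levStd_le ha (fun _ => PUnit) (fun _ _ _ => 0) (fun _ _ _ _ _ => 0)
      (fun _ _ _ => 0) h12) hδC hMC.le hC

end

end Literature.MathematicalPhysics.QuantumFieldTheory.BalabanImbrieJaffe1984to88.BIJ85CurlyDkGradTorus
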